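import Literature.Barriers.CriticalPhenomena.KozmaNachmiasLemma23B3
import Literature.Barriers.CriticalPhenomena.KozmaNachmiasLemma23Params
import Literature.Barriers.CriticalPhenomena.KozmaNachmiasVolumeTail
import HarnessLib

/-!
# Kozma–Nachmias 2011, Lemma 2.3 PROVED from Theorem 2 and (1.1); the upper bound
# `P_{p_c}(0 ↔ ∂Q_r) ≤ C/r²` from Theorem 2 and `γ = 1`

Barrier catalogue `Literature/Barriers/CriticalPhenomena/` (D-0021), companion of
`KozmaNachmiasOneArm.lean`, which reduced the named fact `KozmaNachmias2011_oneArmUpper` (the upper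
half of Kozma–Nachmias 2011, Thm. 1, conditional version) to Lemma 2.3
(`KozmaNachmias2011_oneArmUpper_of_lemma23`). This file PROVES Lemma 2.3 from its two printed inputs,
following the source (pp. 382–384) with `ε = η^{10}`:

* `oneArmProb_le_three` — the covering `{0 ↔ ∂Q_{r(1+λ)}} ⊆ B₁ ∪ B₂ ∪ B₃` and the three bounds:
  `P(B₁) = P(|C(0)| ≥ V)`, `P(B₂) ≤ 2d·T·γ(λr/2)γ(r)` (`KozmaNachmiasLemma23B2.lean`),
  `P(B₃) ≤ (1 - c/2)γ(r)` (`KozmaNachmiasLemma23B3.lean`);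
* `KozmaNachmias2011_lemma23_of : KozmaNachmias2011_volumeTail → KozmaNachmias2011_thm2 →
  KozmaNachmias2011_lemma23` — with the three ranges of the printed proof: small `r` (the constant
  `C₁` makes (2.1) trivial, p. 383), the "uninteresting range" `ε ≤ 2r^{-3}` (here
  `η^{10}r³ ≤ (4d)^{10}`; (1.1) gives `γ(r(1+λ)) ≤ C/√r`, p. 382), and the main range
  (parameters from `lemma23_parameters`);
* `KozmaNachmias2011_oneArmUpper_of_thm2 : AizenmanNewman1984_gamma_eq_one → KozmaNachmias2011_thm2 →
  KozmaNachmias2011_oneArmUpper` — so the named fact is now reduced to Theorem 2 of the source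
  (Chapters 3–5) and Aizenman–Newman's `γ = 1` under the triangle condition;
* `KozmaNachmias2011_rhoExHalf_of_thm2` — with Thm. 11.4 (`Hara2008_etaZeroXSpace`), `ρ_ex = 1/2`
  for `d ≥ 11` (Heydenreich–van der Hofstad 2017, Thm. 11.5 (11.3.2)).

Constants: `c₁ = c/2` with `c = min(c_Thm2, 1/2)`; `C₁ = C_V(4d)⁵ + R₀² + 1` with `R₀ = max(j₀, 1)`
(`C_V` the constant of (1.1), `j₀` the threshold of Theorem 2); `η₀(λ) = c²λ/(4096 d³)`.

## References

* G. Kozma, A. Nachmias, J. Amer. Math. Soc. 24 (2011) 375–409: Lemma 2.3 and its proof,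
  pp. 382–384; Thm. 1 (conditional version, §1.1); Thm. 2 p. 378.
* M. Heydenreich, R. van der Hofstad (2017), Thm. 11.5 (11.3.2) and §11.3.2.
-/

noncomputable section

namespace Literature.Barriers.CriticalPhenomena

open _root_.MeasureTheory Finset Literature.Probability.LatticeModels Literature.Probability.Percolation
  Literature.Probability.Percolation.DCT16
open scoped Literature.Probability.LatticeModels Literature.Probability.Percolation

variable {d : ℕ}

/-! ### The covering `{0 ↔ ∂Q_n} ⊆ B₁ ∪ B₂ ∪ B₃` -/

section Covering

/-- **The three terms of the proof of Lemma 2.3** (Kozma–Nachmias 2011, p. 382: "If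
`0 ↔ ∂Q_{r(1+λ)}`, then one of the following events must occur: (i) `|C(0)| ≥ εr⁴`. (ii) For some
`j ∈ [r(1+λ/4), r(1+λ/2)]` we have `X_j ≤ L²` and `0 ↔ ∂Q_{r(1+λ)}`. (iii) For all `j` … `X_j > L²`
and `|C(0)| < εr⁴`"), with the bounds on `B₂` (`real_siteToBoundary_inter_exists_low_le`) and `B₃`
(`real_compl_clusterSizeGe_inter_forall_lt_le`):
`γ(n) ≤ P(|C(0)| ≥ V) + 2d·T·γ(k₂)γ(j₁) + (1 - c/2)γ(j₁)`.
[cite: KozmaNachmias2011, proof of Lemma 2.3 (pp. 382–384)] -/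
theorem oneArmProb_le_three (hd : 1 ≤ d) (p : unitInterval) {c : ℝ} (hc0 : 0 < c) (hc1 : c ≤ 1)
    {n j₁ j₂ k₂ L N V : ℕ} {T : ℝ} (hT0 : 0 ≤ T) (hn : j₂ + 1 + k₂ ≤ n) (hL : 1 ≤ L) (hN1 : 1 ≤ N)
    (hNj : ∀ i < N, j₁ + i * L ≤ j₂) (hLT : ((L : ℝ)) ^ 2 ≤ T)
    (hG : ∀ i < N, (bondPercolation (zdGraph d) p).real
      {ω | ((L : ℝ)) ^ 2 ≤ (boundaryConnCount d (j₁ + i * L) ω : ℝ) ∧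
        (annulusConnCount d (j₁ + i * L) L ω : ℝ) ≤ c * (L : ℝ) ^ 4} ≤
      (1 - c) * oneArmProb d p j₁)
    (hβ : (V : ℝ) / (c * (L : ℝ) ^ 4) ≤ c * N / 2) :
    oneArmProb d p n ≤ (bondPercolation (zdGraph d) p).real (clusterSizeGe (0 : Site d) V) +
      2 * d * T * oneArmProb d p k₂ * oneArmProb d p j₁ + (1 - c / 2) * oneArmProb d p j₁ := by
  set μ := bondPercolation (zdGraph d) p with hμ
  have hcover : (siteToBoundary d n : Set (BondConfig (Site d))) ⊆
      (clusterSizeGe (0 : Site d) V ∪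
        (siteToBoundary d n ∩ {ω | ∃ j ∈ Finset.Icc j₁ j₂, (boundaryConnCount d j ω : ℝ) ≤ T})) ∪
      ((clusterSizeGe (0 : Site d) V)ᶜ ∩
        {ω | ∀ j ∈ Finset.Icc j₁ j₂, T < (boundaryConnCount d j ω : ℝ)}) := by
    intro ω hω
    by_cases hV : ω ∈ clusterSizeGe (0 : Site d) V
    · exact Or.inl (Or.inl hV)
    by_cases hex : ∃ j ∈ Finset.Icc j₁ j₂, (boundaryConnCount d j ω : ℝ) ≤ T
    · exact Or.inl (Or.inr ⟨hω, hex⟩)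
    · push Not at hex
      exact Or.inr ⟨hV, hex⟩
  have hB2 := real_siteToBoundary_inter_exists_low_le p hd (j₁ := j₁) hn hT0
  have hB3 := real_compl_clusterSizeGe_inter_forall_lt_le p hc0 hc1 (j₂ := j₂) (T := T) hL hN1 hNj
    hLT hG hβ
  calc oneArmProb d p n = μ.real (siteToBoundary d n) := rfl
    _ ≤ μ.real ((clusterSizeGe (0 : Site d) V ∪
          (siteToBoundary d n ∩ {ω | ∃ j ∈ Finset.Icc j₁ j₂, (boundaryConnCount d j ω : ℝ) ≤ T})) ∪
        ((clusterSizeGe (0 : Site d) V)ᶜ ∩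
          {ω | ∀ j ∈ Finset.Icc j₁ j₂, T < (boundaryConnCount d j ω : ℝ)})) := measureReal_mono hcover
    _ ≤ μ.real (clusterSizeGe (0 : Site d) V ∪
          (siteToBoundary d n ∩ {ω | ∃ j ∈ Finset.Icc j₁ j₂, (boundaryConnCount d j ω : ℝ) ≤ T})) +
        μ.real ((clusterSizeGe (0 : Site d) V)ᶜ ∩
          {ω | ∀ j ∈ Finset.Icc j₁ j₂, T < (boundaryConnCount d j ω : ℝ)}) := measureReal_union_le _ _
    _ ≤ μ.real (clusterSizeGe (0 : Site d) V) +
          μ.real (siteToBoundary d n ∩ {ω | ∃ j ∈ Finset.Icc j₁ j₂, (boundaryConnCount d j ω : ℝ) ≤ T}) +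
        μ.real ((clusterSizeGe (0 : Site d) V)ᶜ ∩
          {ω | ∀ j ∈ Finset.Icc j₁ j₂, T < (boundaryConnCount d j ω : ℝ)}) :=
        add_le_add (measureReal_union_le _ _) le_rfl
    _ ≤ _ := add_le_add (add_le_add le_rfl hB2) hB3

end Covering

/-! ### Lemma 2.3 from Theorem 2 and (1.1) -/

section Lemma23

/-- Bounding by the first term: `γ ≤ A` with `B, C ≥ 0` gives `γ ≤ A + B + C`. [folklore] -/
theorem le_add_add_of_le_of_nonneg {γ A B C : ℝ} (h : γ ≤ A) (hB : 0 ≤ B) (hC : 0 ≤ C) :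
    γ ≤ A + B + C := by linarith

/-- The "uninteresting range" arithmetic (p. 382, `ε ≤ 2r^{-3}`, here `η^{10}r³ ≤ (4d)^{10}`):
`η⁵ r² ≤ (4d)⁵ √r`. [cite: KozmaNachmias2011, proof of Lemma 2.3 (p. 382, the case ε ≤ 2r⁻³)] -/
theorem eta_pow_mul_sq_le {d : ℕ} {η r : ℝ} (hη0 : 0 < η) (hr0 : 0 < r)
    (hrb : η ^ 10 * r ^ 3 ≤ (4 * d : ℝ) ^ 10) : η ^ 5 * r ^ 2 ≤ (4 * d : ℝ) ^ 5 * Real.sqrt r := by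
  set s := Real.sqrt r with hs
  have hs0 : 0 < s := Real.sqrt_pos.2 hr0
  have hs2 : s ^ 2 = r := Real.sq_sqrt hr0.le
  have h1 : (η ^ 5 * s ^ 3) ^ 2 ≤ ((4 * d : ℝ) ^ 5) ^ 2 := by
    calc (η ^ 5 * s ^ 3) ^ 2 = η ^ 10 * (s ^ 2) ^ 3 := by ring
      _ = η ^ 10 * r ^ 3 := by rw [hs2]
      _ ≤ (4 * d : ℝ) ^ 10 := hrb
      _ = ((4 * d : ℝ) ^ 5) ^ 2 := by ring
  have h2 : η ^ 5 * s ^ 3 ≤ (4 * d : ℝ) ^ 5 :=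
    (pow_le_pow_iff_left₀ (by positivity) (by positivity) two_ne_zero).1 h1
  calc η ^ 5 * r ^ 2 = η ^ 5 * s ^ 3 * s := by rw [← hs2]; ring
    _ ≤ (4 * d : ℝ) ^ 5 * s := mul_le_mul_of_nonneg_right h2 hs0.le

/-- **Kozma–Nachmias 2011, Lemma 2.3, PROVED from (1.1) and Theorem 2** (pp. 382–384): the named
facts `KozmaNachmias2011_volumeTail` and `KozmaNachmias2011_thm2` imply `KozmaNachmias2011_lemma23`
(the recursive inequality (2.1), `OneArmRecursion`, with `ε = η^{10}`). Printed proof: for `r` small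
the constant `C₁` makes (2.1) trivial; for `ε ≤ 2r^{-3}` (here `η^{10}r³ ≤ (4d)^{10}`),
`γ(r(1+λ)) ≤ P(|C(0)| > r) ≤ C/√r ≤ C₁/(√ε r²)` by (1.1); otherwise `L = ε^{3/10}r`,
`{0 ↔ ∂Q_{r(1+λ)}} ⊆ B₁ ∪ B₂ ∪ B₃` with `P(B₁) ≤ C₁/(√ε r²)` by (1.1),
`P(B₂) ≤ L² γ(λr/2)γ(r)` by the regeneration argument, and `P(B₃) ≤ (1-c₁)γ(r)` by Theorem 2 and
Markov's inequality. [cite: KozmaNachmias2011, Lemma 2.3 and its proof (pp. 382–384)] -/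
theorem KozmaNachmias2011_lemma23_of (hV : KozmaNachmias2011_volumeTail)
    (hT2 : KozmaNachmias2011_thm2) : KozmaNachmias2011_lemma23 := by
  intro d hd hτ
  have hd1 : 1 ≤ d := by omega
  have hd7 : 7 ≤ d := hd
  have hdR : (1 : ℝ) ≤ d := by exact_mod_cast hd1
  have hd0 : (d : ℝ) ≠ 0 := by exact_mod_cast (show d ≠ 0 by omega)
  obtain ⟨C_V, hCV⟩ := hV d hd hτ
  obtain ⟨c₀, hc₀, j₀, hthm⟩ := hT2 d hd hτ
  set p := criticalProbI d with hp
  set μ := bondPercolation (zdGraph d) p with hμ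
  -- `γ` and its basic properties
  have hγ0 : ∀ n, 0 ≤ oneArmProb d p n := fun n => measureReal_nonneg
  have hγ1 : ∀ n, oneArmProb d p n ≤ 1 := fun n => measureReal_le_one
  have hγanti : ∀ {m n : ℕ}, m ≤ n → oneArmProb d p n ≤ oneArmProb d p m :=
    fun hmn => real_siteToBoundary_antitone p hmn
  -- `C_V ≥ 0` (from `n = 1`)
  have hCV0 : 0 ≤ C_V := by
    have h := hCV 1 le_rfl
    rw [Nat.cast_one, Real.sqrt_one, div_one] at h
    exact le_trans measureReal_nonneg h
  -- WLOG `c ≤ 1/2`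
  set c : ℝ := min c₀ (1 / 2) with hc_def
  have hc0 : 0 < c := lt_min hc₀ (by norm_num)
  have hc2 : c ≤ 1 / 2 := min_le_right _ _
  have hcc₀ : c ≤ c₀ := min_le_left _ _
  have hc1 : c ≤ 1 := by linarith
  have hthm' : ∀ j : ℕ, j₀ ≤ j → ∀ L : ℕ, (j : ℝ) ^ ((1 : ℝ) / 10) ≤ L → L ≤ j →
      μ.real {ω | ((L : ℝ)) ^ 2 ≤ (boundaryConnCount d j ω : ℝ) ∧
        (annulusConnCount d j L ω : ℝ) ≤ c * (L : ℝ) ^ 4} ≤ (1 - c) * oneArmProb d p j := by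
    intro j hj L hL1 hL2
    refine le_trans (measureReal_mono ?_) ((hthm j hj L hL1 hL2).trans ?_)
    · rintro ω ⟨h1, h2⟩
      exact ⟨h1, h2.trans (mul_le_mul_of_nonneg_right hcc₀ (by positivity))⟩
    · exact mul_le_mul_of_nonneg_right (by linarith) (hγ0 j)
  -- the constants of the recursion
  set R₀ : ℝ := max (j₀ : ℝ) 1 with hR₀
  have hR₀1 : 1 ≤ R₀ := le_max_right _ _
  have hR₀j : (j₀ : ℝ) ≤ R₀ := le_max_left _ _
  set C₁ : ℝ := C_V * (4 * d) ^ 5 + R₀ ^ 2 + 1 with hC₁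
  have h4d : (1 : ℝ) ≤ (4 * d : ℝ) ^ 5 := one_le_pow₀ (by linarith)
  have hCV5 : 0 ≤ C_V * (4 * d) ^ 5 := mul_nonneg hCV0 (by positivity)
  have hR₀sq : 0 ≤ R₀ ^ 2 := sq_nonneg _
  have hC₁V : C_V * (4 * d) ^ 5 ≤ C₁ := by rw [hC₁]; linarith
  have hC₁V' : C_V ≤ C₁ := le_trans (le_mul_of_one_le_right hCV0 h4d) hC₁V
  have hC₁R : R₀ ^ 2 < C₁ := by rw [hC₁]; linarith
  have hC₁0 : 0 < C₁ := by rw [hC₁]; linarith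
  refine ⟨c / 2, C₁, by positivity, hC₁0, fun lam hlam0 hlam1 => ?_⟩
  refine ⟨c ^ 2 * lam / (4096 * d ^ 3), by positivity, fun η hη0 hηη₀ r hr0 => ?_⟩
  have hη1 : η ≤ 1 := by
    refine hηη₀.le.trans ?_
    rw [div_le_one (by positivity)]
    have h1 : c ^ 2 ≤ 1 := by nlinarith
    have h3 : (1 : ℝ) ≤ d ^ 3 := one_le_pow₀ hdR
    calc c ^ 2 * lam ≤ 1 * 1 := mul_le_mul h1 hlam1 hlam0.le zero_le_one
      _ ≤ 4096 * d ^ 3 := by linarith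
  -- the three values of `γ` in (2.1) are at `n = ⌊r(1+λ)⌋`, `k = ⌊r⌋`, `k₂ = ⌊λr/2⌋`
  have hterm2 : 0 ≤ η ^ 6 * r ^ 2 * oneArmProb d p ⌊r⌋₊ * oneArmProb d p ⌊lam * r / 2⌋₊ :=
    mul_nonneg (mul_nonneg (by positivity) (hγ0 _)) (hγ0 _)
  have hterm3 : 0 ≤ (1 - c / 2) * oneArmProb d p ⌊r⌋₊ := mul_nonneg (by linarith) (hγ0 _)
  have hnr : r < (⌊r * (1 + lam)⌋₊ : ℝ) + 1 := by
    calc r ≤ r * (1 + lam) := le_mul_of_one_le_right hr0.le (by linarith)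
      _ < ⌊r * (1 + lam)⌋₊ + 1 := Nat.lt_floor_add_one _
  -- range (a): `r < R₀`
  rcases lt_or_ge r R₀ with hra | hrR
  · refine le_add_add_of_le_of_nonneg ((hγ1 _).trans ?_) hterm2 hterm3
    rw [le_div_iff₀ (by positivity), one_mul]
    calc η ^ 5 * r ^ 2 ≤ 1 * R₀ ^ 2 := by
          refine mul_le_mul (pow_le_one₀ hη0.le hη1) ?_ (by positivity) zero_le_one
          exact pow_le_pow_left₀ hr0.le hra.le 2
      _ ≤ C₁ := by linarith
  have hr1 : 1 ≤ r := hR₀1.trans hrR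
  -- range (b): `η^{10} r³ ≤ (4d)^{10}` — use (1.1) directly
  rcases le_or_gt (η ^ 10 * r ^ 3) ((4 * d : ℝ) ^ 10) with hrb | hrc
  · refine le_add_add_of_le_of_nonneg ?_ hterm2 hterm3
    have hsr : 0 < Real.sqrt r := Real.sqrt_pos.2 hr0
    calc oneArmProb d p ⌊r * (1 + lam)⌋₊
          ≤ μ.real (clusterSizeGe (0 : Site d) (⌊r * (1 + lam)⌋₊ + 1)) :=
          oneArmProb_le_real_clusterSizeGe hd1 p _
      _ ≤ C_V / Real.sqrt ((⌊r * (1 + lam)⌋₊ + 1 : ℕ) : ℝ) := hCV _ (by omega)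
      _ ≤ C_V / Real.sqrt r := by
          refine div_le_div_of_nonneg_left hCV0 hsr (Real.sqrt_le_sqrt ?_)
          push_cast; exact hnr.le
      _ ≤ C₁ / (η ^ 5 * r ^ 2) := by
          rw [div_le_div_iff₀ hsr (by positivity)]
          calc C_V * (η ^ 5 * r ^ 2) ≤ C_V * ((4 * d : ℝ) ^ 5 * Real.sqrt r) :=
                mul_le_mul_of_nonneg_left (eta_pow_mul_sq_le hη0 hr0 hrb) hCV0
            _ = C_V * (4 * d) ^ 5 * Real.sqrt r := by ring
            _ ≤ C₁ * Real.sqrt r := mul_le_mul_of_nonneg_right hC₁V hsr.le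
  -- range (c): the main argument
  obtain ⟨j₁, j₂, L, N, V, hP1, hL1, hN1, hP4, hP5, hP8, hP9, hP10, hk1, hVge, hV1⟩ :=
    lemma23_parameters hd7 hc0 hc2 hlam0 hlam1 hη0 hηη₀.le hr1 hrc (hR₀j.trans hrR)
  have hT0 : 0 ≤ η ^ 6 * r ^ 2 / (2 * d) := by positivity
  have hG : ∀ i < N, μ.real {ω | ((L : ℝ)) ^ 2 ≤ (boundaryConnCount d (j₁ + i * L) ω : ℝ) ∧
      (annulusConnCount d (j₁ + i * L) L ω : ℝ) ≤ c * (L : ℝ) ^ 4} ≤ (1 - c) * oneArmProb d p j₁ := by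
    intro i hi
    obtain ⟨hj₀, hrpow, hLj⟩ := hP9 i hi
    refine (hthm' _ hj₀ L hrpow hLj).trans ?_
    exact mul_le_mul_of_nonneg_left (hγanti (Nat.le_add_right _ _)) (by linarith)
  have h3 := oneArmProb_le_three hd1 p hc0 hc1 hT0 hP1 hL1 hN1 hP4 hP5 hG hP8
  -- the three terms
  have hB1 : μ.real (clusterSizeGe (0 : Site d) V) ≤ C₁ / (η ^ 5 * r ^ 2) := by
    refine (hCV V hV1).trans ?_
    have hsV : η ^ 5 * r ^ 2 ≤ Real.sqrt V := by
      rw [show η ^ 5 * r ^ 2 = Real.sqrt ((η ^ 5 * r ^ 2) ^ 2) from (Real.sqrt_sq (by positivity)).symm]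
      refine Real.sqrt_le_sqrt ?_
      calc (η ^ 5 * r ^ 2) ^ 2 = η ^ 10 * r ^ 4 := by ring
        _ ≤ (V : ℝ) := hVge
    calc C_V / Real.sqrt V ≤ C_V / (η ^ 5 * r ^ 2) := div_le_div_of_nonneg_left hCV0 (by positivity) hsV
      _ ≤ C₁ / (η ^ 5 * r ^ 2) := div_le_div_of_nonneg_right hC₁V' (by positivity)
  have hB2 : 2 * d * (η ^ 6 * r ^ 2 / (2 * d)) * oneArmProb d p ⌊lam * r / 2⌋₊ * oneArmProb d p j₁ ≤
      η ^ 6 * r ^ 2 * oneArmProb d p ⌊r⌋₊ * oneArmProb d p ⌊lam * r / 2⌋₊ := by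
    have h1 : 2 * d * (η ^ 6 * r ^ 2 / (2 * d)) = η ^ 6 * r ^ 2 := by field_simp
    rw [h1]
    calc η ^ 6 * r ^ 2 * oneArmProb d p ⌊lam * r / 2⌋₊ * oneArmProb d p j₁
        ≤ η ^ 6 * r ^ 2 * oneArmProb d p ⌊lam * r / 2⌋₊ * oneArmProb d p ⌊r⌋₊ :=
          mul_le_mul_of_nonneg_left (hγanti hP10) (mul_nonneg (by positivity) (hγ0 _))
      _ = η ^ 6 * r ^ 2 * oneArmProb d p ⌊r⌋₊ * oneArmProb d p ⌊lam * r / 2⌋₊ := by ring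
  have hB3 : (1 - c / 2) * oneArmProb d p j₁ ≤ (1 - c / 2) * oneArmProb d p ⌊r⌋₊ :=
    mul_le_mul_of_nonneg_left (hγanti hP10) (by linarith)
  linarith

end Lemma23

/-! ### The named fact from Theorem 2 and `γ = 1` -/

section Assembly

/-- **The upper bound of Kozma–Nachmias 2011, Thm. 1 (conditional version), from Theorem 2 and
`γ = 1`**: the named fact `KozmaNachmias2011_oneArmUpper` (`P_{p_c}(0 ↔ ∂Q_n) ≤ C/n²` for `d > 6`
under the two-point estimate) follows from `KozmaNachmias2011_thm2` (Chapters 3–5 of the source) and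
Aizenman–Newman's `γ = 1` under the triangle condition (`AizenmanNewman1984_gamma_eq_one`, which gives
(1.1) through `KozmaNachmias2011_volumeTail_of_gamma`): Lemma 2.3 (`KozmaNachmias2011_lemma23_of`)
and the induction of §2 (`KozmaNachmias2011_oneArmUpper_of_lemma23`).
[cite: KozmaNachmias2011, Thm. 1 (conditional version, §1.1) and §2] -/
theorem KozmaNachmias2011_oneArmUpper_of_thm2 (h₁ : AizenmanNewman1984_gamma_eq_one)
    (h₂ : KozmaNachmias2011_thm2) : KozmaNachmias2011_oneArmUpper :=
  KozmaNachmias2011_oneArmUpper_of_lemma23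
    (KozmaNachmias2011_lemma23_of (KozmaNachmias2011_volumeTail_of_gamma h₁) h₂)

/-- Hence `ρ_ex = 1/2` in the bounded-ratio sense for `d > 6` under the two-point estimate, granted
Theorem 2 and `γ = 1`. [cite: KozmaNachmias2011, Thm. 1 (conditional version, §1.1)] -/
theorem KozmaNachmias2011_thm2.rhoExHalf (h₂ : KozmaNachmias2011_thm2)
    (h₁ : AizenmanNewman1984_gamma_eq_one) (hd : 6 < d) (hτ : TwoPointBoundedRatio d) : RhoExHalf d :=
  (KozmaNachmias2011_oneArmUpper_of_thm2 h₁ h₂).rhoExHalf hd hτ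

/-- **Thm. 11.5 (11.3.2) of Heydenreich–van der Hofstad 2017 from Thm. 11.4, Kozma–Nachmias's
Theorem 2 and `γ = 1`**: `KozmaNachmias2011_rhoExHalf` (`ρ_ex = 1/2` for `d ≥ 11`).
[cite: HeydenreichVanDerHofstad2017, Thm. 11.5 (11.3.2) and §11.3.2] -/
theorem KozmaNachmias2011_rhoExHalf_of_thm2 (h₀ : Hara2008_etaZeroXSpace)
    (h₁ : AizenmanNewman1984_gamma_eq_one) (h₂ : KozmaNachmias2011_thm2) :
    KozmaNachmias2011_rhoExHalf :=
  KozmaNachmias2011_rhoExHalf_of h₀ (KozmaNachmias2011_oneArmUpper_of_thm2 h₁ h₂)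

end Assembly

end Literature.Barriers.CriticalPhenomena

end
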